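import Mathlib
import Literature.MathematicalPhysics.QuantumFieldTheory.Balaban1983to89.Beta.InfiniteVolumeRate

/-!
# `Balaban1983to89.Beta.VolumeImages` — the method of images on the torus `(ℤ/s)^d`: an EXPLICIT volume rate for image
# sums of (5.10)-decaying kernels, and a small calculus of volume rates (sums, scalars, pointwise products)

T. Bałaban, *Renormalization group approach to lattice gauge field theories. I. Generation of effective actions in a
small field approximation and a coupling constant renormalization in four dimensions*, Commun. Math. Phys. **109**,
249–301 (1987) [Balaban1987RG1] (cell paper B12; PDF page = journal page − 248; PDF held:
`paper:balaban1987-cmp109-rg-i-small-field`).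

HONEST FRAMING (cell rule, verbatim): discharging `BetaPertH` makes Bałaban's UV stability UNCONDITIONAL — a real
constructive-QFT result; it is NOT the continuum limit and NOT the Clay problem.  THIS MODULE ASSERTS NOTHING about the
series and nothing about β: every declaration is a kernel-checked theorem about ABSTRACT kernels on `ℤ^d` and on the
tori `Site d (side t)` of the β sub-cell's carrier (`Beta/OneLoop.lean`, pv25), over the sibling modules
`Beta/InfiniteVolume.lean` (pv01 gen 3: `InWindow`, `windowMap`, `siteOf`, `UniformDecay`) and
`Beta/InfiniteVolumeRate.lean` (this unit, gen 3: the typed hypothesis `VolumeRate`, the explicit finite-volume error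
`abs_torusSecondMoment_sub_secondMoment_le`, `OneLoopDictionary.hsmall_of_volumeRate`), which are IMPORTED AND USED BY
NAME.  Value = kernel lemmas behind a located gap (GAPS G-beta-4 / G-pv01-7 / G-pv04-5), NOT summit progress.

WHAT THE PAPER PRINTS (quotations read on the x2 page renders held by the cell, `…1987-cmp109-rg-I-small-field-p016-x2.png`
and `…-p045-x2.png`; CONTEXT ONLY — nothing of the paper is restated as a fact here).  p. 264, after (1.21): "Now we take a
limit of these functions as T^{(j+1)} ↗ Z^d. This limit exists by the localized representation (1.7)."; (1.22), verbatim
with ellipsis (v1.1, DOCFIX-1 GAPS G-pv24-2: v1 carried a condensed form inside quotation marks): "The function β_{j+1}(g_j) is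
defined by … = Σ_x Π_{j+1,μν}(g_j, x) x_μ x_ν (1.22) for μ, ν arbitrary, μ ≠ ν"; p. 293, (5.10): "∣Π_{μν}(x − y)∣ ≦ O(1)E₀
exp(−δ₁∣x − y∣)".  Print states the
EXISTENCE of the infinite-volume limit and NO RATE; `Beta/InfiniteVolumeRate.lean` typed a rate as the hypothesis
`VolumeRate side P Pinf ρ δ` and showed what it buys (an explicit error for the (1.22) second moment on one torus, hence
the (AF-0s) list `∀ k < k₀, ¾·binf ≤ S.β0 k` from CERTIFIED torus values).  GAPS G-pv04-5 (Q2) recorded that for Bałaban's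
kernels such a rate is expected but NOT printed.  THIS MODULE supplies the classical mechanism that PRODUCES a rate — the
METHOD OF IMAGES — as hypothesis-typed kernel theorems, so that (Q2) is refined to a STRUCTURAL input:

* §1 WINDOW GEOMETRY.  For a window point `w` (`InWindow s (w i)` for all `i`, i.e. `w ∈ ]−s/2, s/2]^d`) and any
  `n ∈ ℤ^d`:  `½∣w∣₁ + (s/4)∣n∣₁ ≤ ∣w + s·n∣₁` (`l1_window_imageShift_ge`), hence for `δ ≥ 0`
  `e^{−δ∣w + s·n∣₁} ≤ e^{−(δ/2)∣w∣₁}·e^{−(δs/4)∣n∣₁}` (`exp_imageShift_le`).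
* §2 THE IMAGE TAIL `imageTail d a := Σ_{n ∈ ℤ^d, n ≠ 0} e^{−a∣n∣₁}`: `0 ≤ imageTail`, the explicit bound
  `imageTail d a ≤ e^{−(a−b)}·Σ_{n∈ℤ^d} e^{−b∣n∣₁}` for `0 < b ≤ a` (`imageTail_le`), `imageTail d a → 0` as `a → ∞`
  (`tendsto_imageTail_atTop`) and along `a_t = δ·side t/4` with `side t → ∞` (`tendsto_imageTail_side`).
* §3 THE METHOD OF IMAGES.  Typed STRUCTURAL hypothesis `IsImageSum side F Finf` (scalar) / `IsImageSumKernel side P Pinf`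
  (`μν`-indexed): the torus function at `x` is the sum of the `ℤ^d` function over the periodic images `windowMap x + s·n`,
  `n ∈ ℤ^d` (`HasSum` form — no junk value).  It does not depend on the chosen representative of the class
  (`hasSum_imageShift_iff_of_siteOf_eq`).  MAIN THEOREM (`IsImageSumKernel.volumeRate`): image sums of kernels obeying
  (5.10) with `(C, δ)`, `δ > 0`, satisfy `VolumeRate side P Pinf (fun t => C·imageTail d (δ·side t/4)) (δ/2)` — an EXPLICIT,
  exponentially small volume rate; corollaries `IsImageSumKernel.isInfiniteVolumeLimit` ((1.21) as typed by pv25 follows),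
  `IsImageSumKernel.abs_torusSecondMoment_sub_le` (the explicit second-moment error with this rate).
* §4 A CALCULUS OF RATES (scalar form `ScalarVolumeRate`, and `volumeRate_iff_scalar`): closure under finite sums
  (`ScalarVolumeRate.add`), scalar multiples (`.const_mul`) and POINTWISE PRODUCTS (`.mul`, rate
  `ρ₁(C₂ + ρ₂) + C₁ρ₂`), so that a torus expression POLYNOMIAL in image sums of decaying `ℤ^d` kernels inherits an
  explicit rate.
* §5 READ ON pv25's `OneLoopDictionary`: `OneLoopDictionary.abs_torusBetaZero_sub_beta0_le_of_images` (the error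
  `imageError d C δ (D.side k t)` for row num's observable `β⁰_T`, no free rate) and `OneLoopDictionary.hsmall_of_images`
  (the literal (AF-0s) binder `hsmall : ∀ k < k₀, ¾β⁰_∞ ≤ S.β0 k` of `FlowStepRuns.thm2Printed_of_limitSplit` from:
  (5.10) constants for the limit kernels, the image-sum structure, and ONE certified torus inequality per `k < k₀`).

HONEST CAVEAT (why §4 exists and what is NOT here).  A one-loop kernel is a second derivative of a Gaussian normalisation
and in general contains PRODUCTS of propagators (the `tr(G·∂Δ·G·∂Δ)` term of `∂²(−½·tr log Δ)`); the torus version of such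
a product is the product of the image sums, which is NOT the image sum of the `ℤ^d` product (cross-winding terms, of size
`O(e^{−δs/4})`).  So `IsImageSum` is the right hypothesis for kernels LINEAR in a periodised translation-invariant operator,
and §4 is what propagates rates through products; closure under torus CONVOLUTION and under the reflection `x ↦ −x` (window
boundary effects for even `s`) is NOT typed here and is recorded as the next kernel node (GAPS G-pv04-7).  Whether Bałaban's
one-loop kernel `Π⁰_{k+1}` on `T` is such a polynomial expression in image sums of `ℤ^d` kernels with (5.10)-decay and
explicit constants is the refined located input (Q2′) — a statement about HIS construction (B5/B6/B9 random-walk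
representations at the trivial background), NOT printed and NOT asserted here.

ABSOLUTE RULE.  No internally-minted statement enters as a cited fact: there are no cited facts in this file — every
declaration is proved here from Mathlib and the tree modules named above; `IsImageSum` / `IsImageSumKernel` /
`ScalarVolumeRate` are `Prop`-valued definitions used only to the LEFT of `→`.  Companion prose:
`run/shared/lean/pub/pub-balaban/b2b-balaban-pv04/VOLUME-IMAGES.md`; GAPS rows C-pv04-11 / G-pv04-7.
-/

namespace Literature.MathematicalPhysics.QuantumFieldTheory.Balaban1983to89.Beta

open Literature.MathematicalPhysics.QuantumFieldTheory.Balaban1983to89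
open Literature.MathematicalPhysics.QuantumFieldTheory.Balaban1983to89.B12Sec2to5 (l1 l1_nonneg abs_coord_le_l1
  Decay510 summable_exp_neg_l1 betaPrime510)
open _root_.Filter
open scoped _root_.Topology

/-! ## §1. Window geometry for the method of images -/

/-- The periodic image `w + s·n` (`n ∈ ℤ^d`) of a point `w ∈ ℤ^d` for the torus of side `s`. [folklore] -/
def imageShift {d : ℕ} (s : ℕ) (w n : Fin d → ℤ) : Fin d → ℤ := fun i => w i + (s : ℤ) * n i

/-- Coordinates of the image point. [folklore] -/
@[simp] theorem imageShift_apply {d : ℕ} (s : ℕ) (w n : Fin d → ℤ) (i : Fin d) :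
    imageShift s w n i = w i + (s : ℤ) * n i := rfl

/-- The image `n = 0` is the point itself. [folklore] -/
@[simp] theorem imageShift_zero {d : ℕ} (s : ℕ) (w : Fin d → ℤ) : imageShift s w 0 = w := by
  funext i; simp [imageShift]

/-- Images compose additively: the `n`-image of the `m`-image is the `(m + n)`-image. [folklore] -/
theorem imageShift_add {d : ℕ} (s : ℕ) (w m n : Fin d → ℤ) :
    imageShift s (imageShift s w m) n = imageShift s w (m + n) := by
  funext i; simp [imageShift]; ring

/-- One coordinate: for `w` in the window `]−s/2, s/2]` and any integer `n`, `½|w| + (s/4)|n| ≤ |w + s·n|`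
(trivial for `n = 0`; for `n ≠ 0`, `|w + sn| ≥ s|n| − |w|`, `s|n| ≥ s ≥ 2|w|`). [folklore] -/
theorem abs_window_add_mul_ge {s : ℕ} {w : ℤ} (hw : InWindow s w) (n : ℤ) :
    |(w : ℝ)| / 2 + (s : ℝ) / 4 * |(n : ℝ)| ≤ |((w + (s : ℤ) * n : ℤ) : ℝ)| := by
  have hw2 : 2 * |(w : ℝ)| ≤ s := by
    obtain ⟨h1, h2⟩ := hw
    have h1' : (-(s : ℝ)) < 2 * (w : ℝ) := by exact_mod_cast h1
    have h2' : 2 * (w : ℝ) ≤ (s : ℝ) := by exact_mod_cast h2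
    have : |(w : ℝ)| ≤ (s : ℝ) / 2 := abs_le.mpr ⟨by linarith, by linarith⟩
    linarith
  push_cast
  by_cases hn : n = 0
  · subst hn
    simp only [Int.cast_zero, abs_zero, mul_zero, add_zero]
    linarith [abs_nonneg (w : ℝ)]
  · have hn1 : (1 : ℝ) ≤ |(n : ℝ)| := by exact_mod_cast Int.one_le_abs hn
    have hs0 : (0 : ℝ) ≤ s := Nat.cast_nonneg s
    have hsn : (s : ℝ) ≤ (s : ℝ) * |(n : ℝ)| := by nlinarith
    have htri : (s : ℝ) * |(n : ℝ)| - |(w : ℝ)| ≤ |(w : ℝ) + (s : ℝ) * (n : ℝ)| := by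
      have h := abs_sub_abs_le_abs_sub ((s : ℝ) * (n : ℝ)) (-(w : ℝ))
      rw [abs_mul, abs_of_nonneg hs0, abs_neg, sub_neg_eq_add, add_comm] at h
      exact h
    linarith

/-- `d` coordinates: for `w` in the window cube and `n ∈ ℤ^d`, `½|w|₁ + (s/4)|n|₁ ≤ |w + s·n|₁`. [folklore] -/
theorem l1_window_imageShift_ge {d s : ℕ} {w : Fin d → ℤ} (hw : ∀ i, InWindow s (w i)) (n : Fin d → ℤ) :
    l1 w / 2 + (s : ℝ) / 4 * l1 n ≤ l1 (imageShift s w n) := by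
  unfold l1
  rw [Finset.sum_div, Finset.mul_sum, ← Finset.sum_add_distrib]
  exact Finset.sum_le_sum fun i _ => by
    simpa [imageShift] using abs_window_add_mul_ge (hw i) (n i)

/-- Exponential form: for `δ ≥ 0`, `w` in the window and `n ∈ ℤ^d`,
`e^{−δ|w + s·n|₁} ≤ e^{−(δ/2)|w|₁} · e^{−(δs/4)|n|₁}`. [folklore] -/
theorem exp_imageShift_le {d s : ℕ} {δ : ℝ} (hδ : 0 ≤ δ) {w : Fin d → ℤ} (hw : ∀ i, InWindow s (w i))
    (n : Fin d → ℤ) :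
    Real.exp (-δ * l1 (imageShift s w n)) ≤
      Real.exp (-(δ / 2) * l1 w) * Real.exp (-(δ * s / 4) * l1 n) := by
  rw [← Real.exp_add, Real.exp_le_exp]
  have h := mul_le_mul_of_nonneg_left (l1_window_imageShift_ge hw n) hδ
  have e : δ * (l1 w / 2 + (s : ℝ) / 4 * l1 n) = (δ / 2) * l1 w + (δ * s / 4) * l1 n := by ring
  linarith

/-- A nonzero lattice point has `|n|₁ ≥ 1`. [folklore] -/
theorem one_le_l1_of_ne_zero {d : ℕ} {n : Fin d → ℤ} (hn : n ≠ 0) : 1 ≤ l1 n := by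
  obtain ⟨i, hi⟩ : ∃ i, n i ≠ 0 := by
    by_contra h
    exact hn (funext fun i => by simpa using not_exists.mp h i)
  have h1 : (1 : ℝ) ≤ |(n i : ℝ)| := by exact_mod_cast Int.one_le_abs hi
  exact h1.trans (abs_coord_le_l1 n i)

/-! ## §2. The image tail `Σ_{n ≠ 0} e^{−a|n|₁}` -/

/-- The image tail `imageTail d a := Σ_{n ∈ ℤ^d, n ≠ 0} e^{−a|n|₁}` (for `a > 0`; `= coth(a/2)^d − 1`). [folklore] -/
noncomputable def imageTail (d : ℕ) (a : ℝ) : ℝ :=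
  ∑' n : Fin d → ℤ, if n = 0 then 0 else Real.exp (-a * l1 n)

/-- The terms of the image tail are `≥ 0`. [folklore] -/
theorem imageTail_term_nonneg {d : ℕ} (a : ℝ) (n : Fin d → ℤ) :
    0 ≤ (if n = 0 then (0 : ℝ) else Real.exp (-a * l1 n)) := by
  split_ifs
  · exact le_rfl
  · exact (Real.exp_pos _).le

/-- The tail series converges for `a > 0` (dominated by `Σ_n e^{−a|n|₁}`, `B12Sec2to5.summable_exp_neg_l1`). [folklore] -/
theorem summable_imageTail_term {d : ℕ} {a : ℝ} (ha : 0 < a) :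
    Summable (fun n : Fin d → ℤ => if n = 0 then (0 : ℝ) else Real.exp (-a * l1 n)) :=
  Summable.of_nonneg_of_le (imageTail_term_nonneg a)
    (fun n => by
      split_ifs
      · exact (Real.exp_pos _).le
      · exact le_rfl)
    (summable_exp_neg_l1 ha d)

/-- `0 ≤ imageTail d a` (for every `a`; for `a ≤ 0` and `d ≥ 1` the series diverges and `tsum` returns `0`). [folklore] -/
theorem imageTail_nonneg (d : ℕ) (a : ℝ) : 0 ≤ imageTail d a :=
  tsum_nonneg (imageTail_term_nonneg a)

/-- EXPLICIT BOUND: for `0 < b ≤ a`, `imageTail d a ≤ e^{−(a−b)} · Σ_{n∈ℤ^d} e^{−b|n|₁}` (on `n ≠ 0`, `|n|₁ ≥ 1`, so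
`e^{−a|n|₁} = e^{−(a−b)|n|₁}e^{−b|n|₁} ≤ e^{−(a−b)}e^{−b|n|₁}`). [folklore] -/
theorem imageTail_le {d : ℕ} {a b : ℝ} (hb : 0 < b) (hba : b ≤ a) :
    imageTail d a ≤ Real.exp (-(a - b)) * ∑' n : Fin d → ℤ, Real.exp (-b * l1 n) := by
  rw [← tsum_mul_left]
  refine (summable_imageTail_term (hb.trans_le hba)).tsum_le_tsum (fun n => ?_)
    ((summable_exp_neg_l1 hb d).mul_left _)
  split_ifs with hn
  · positivity
  · rw [← Real.exp_add, Real.exp_le_exp]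
    have h1 := one_le_l1_of_ne_zero hn
    nlinarith

/-- `imageTail d a → 0` as `a → ∞` (squeeze with `imageTail_le` at `b = 1`). [folklore] -/
theorem tendsto_imageTail_atTop (d : ℕ) : Tendsto (imageTail d) atTop (𝓝 0) := by
  set S : ℝ := ∑' n : Fin d → ℤ, Real.exp (-1 * l1 n) with hS
  have hmaj : Tendsto (fun a : ℝ => Real.exp (-(a - 1)) * S) atTop (𝓝 0) := by
    have h1 : Tendsto (fun a : ℝ => -(a - 1)) atTop atBot := by
      have : Tendsto (fun a : ℝ => a - 1) atTop atTop := tendsto_atTop_add_const_right _ _ tendsto_id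
      exact tendsto_neg_atTop_atBot.comp this
    have h2 := Real.tendsto_exp_atBot.comp h1
    simpa using h2.mul_const S
  refine squeeze_zero' (Eventually.of_forall fun a => imageTail_nonneg d a) ?_ hmaj
  filter_upwards [eventually_ge_atTop (1 : ℝ)] with a ha
  simpa [hS] using imageTail_le (d := d) one_pos ha

/-- Along growing sides: `C · imageTail d (δ·side t/4) → 0` for `δ > 0`, `side t → ∞`. [folklore] -/
theorem tendsto_imageTail_side {side : ℕ → ℕ} {δ : ℝ} (hδ : 0 < δ) (hside : Tendsto side atTop atTop) (d : ℕ)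
    (C : ℝ) : Tendsto (fun t => C * imageTail d (δ * side t / 4)) atTop (𝓝 0) := by
  have h1 : Tendsto (fun t => δ * (side t : ℝ) / 4) atTop atTop :=
    Tendsto.atTop_div_const (by norm_num) (Tendsto.const_mul_atTop hδ (tendsto_natCast_atTop_atTop.comp hside))
  simpa using ((tendsto_imageTail_atTop d).comp h1).const_mul C

/-- The EXPLICIT finite-volume error of the (1.22) second moment produced by the method of images for a kernel obeying
(5.10) with `(C, δ)` on the torus of side `s` (see `IsImageSumKernel.abs_torusSecondMoment_sub_le`):
`β′(C·imageTail d (δs/4), δ/2) + e^{−(δ/2)s/4}·β′(C, δ/4)` with `β′ = B12Sec2to5.betaPrime510`. [folklore] -/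
noncomputable def imageError (d : ℕ) (C δ : ℝ) (s : ℕ) : ℝ :=
  betaPrime510 d (C * imageTail d (δ * s / 4)) (δ / 2) + Real.exp (-(δ / 2) * s / 4) * betaPrime510 d C (δ / 2 / 2)

/-! ## §3. The method of images: image sums have an explicit volume rate -/

section Images

variable {d : ℕ}

/-- Two representatives of the same torus point differ by `s·m`: if `siteOf d s y = x` then
`y = imageShift s (windowMap d s x) m` for some `m ∈ ℤ^d`. [folklore] -/
theorem exists_eq_imageShift_of_siteOf_eq {s : ℕ} [NeZero s] {y : Fin d → ℤ} {x : Site d s}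
    (hy : siteOf d s y = x) : ∃ m : Fin d → ℤ, y = imageShift s (windowMap d s x) m := by
  have h : ∀ i, ∃ m : ℤ, y i = windowMap d s x i + (s : ℤ) * m := by
    intro i
    have h1 : ((y i : ℤ) : ZMod s) = ((windowMap d s x i : ℤ) : ZMod s) := by
      have e1 : ((windowMap d s x i : ℤ) : ZMod s) = x i := intCast_symmRep s (x i)
      rw [e1]
      exact congrFun hy i
    obtain ⟨m, hm⟩ := (ZMod.intCast_eq_intCast_iff_dvd_sub _ _ _).mp h1.symm
    exact ⟨m, by linarith⟩
  choose m hm using h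
  exact ⟨m, funext fun i => by simpa [imageShift] using hm i⟩

/-- REPRESENTATIVE INDEPENDENCE of image sums: summing `f` over the images of ANY lift `y` of `x` is summing over the
images of the window representative (re-indexing `n ↦ n + m`). [folklore] -/
theorem hasSum_imageShift_iff_of_siteOf_eq {s : ℕ} [NeZero s] (f : (Fin d → ℤ) → ℝ) {y : Fin d → ℤ}
    {x : Site d s} (hy : siteOf d s y = x) (a : ℝ) :
    HasSum (fun n => f (imageShift s y n)) a ↔ HasSum (fun n => f (imageShift s (windowMap d s x) n)) a := by
  obtain ⟨m, rfl⟩ := exists_eq_imageShift_of_siteOf_eq hy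
  have : (fun n => f (imageShift s (imageShift s (windowMap d s x) m) n)) =
      (fun n => f (imageShift s (windowMap d s x) n)) ∘ (Equiv.addLeft m) := by
    funext n
    simp [imageShift_add]
  rw [this, Equiv.hasSum_iff]

variable {side : ℕ → ℕ} [∀ t, NeZero (side t)]

/-- **TYPED STRUCTURAL HYPOTHESIS (method of images; NOT printed in [Balaban1987RG1] — the located unprinted input (Q2) of
GAPS G-pv04-5 in structural form), scalar version.**  The torus function `F t` at `x` is the sum of the `ℤ^d` function
`Finf` over the periodic images of the window representative of `x` (`HasSum`: the series converges to that value).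
A `Prop`, used only to the left of `→`. [cite: Balaban1987RG1, (1.21) p.264] -/
def IsImageSum (side : ℕ → ℕ) [∀ t, NeZero (side t)] (F : (t : ℕ) → Site d (side t) → ℝ)
    (Finf : (Fin d → ℤ) → ℝ) : Prop :=
  ∀ (t : ℕ) (x : Site d (side t)),
    HasSum (fun n : Fin d → ℤ => Finf (imageShift (side t) (windowMap d (side t) x) n)) (F t x)

/-- The `μν`-indexed version for kernels `P t μ ν` / `Pinf μ ν` (the shape of `VolumeRate`). [cite: Balaban1987RG1, (1.21) p.264] -/
def IsImageSumKernel (side : ℕ → ℕ) [∀ t, NeZero (side t)]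
    (P : (t : ℕ) → Fin d → Fin d → Site d (side t) → ℝ) (Pinf : B12Beta.Kernel d) : Prop :=
  ∀ μ ν : Fin d, IsImageSum side (fun t => P t μ ν) (Pinf μ ν)

/-- **A VOLUME RATE, scalar form**: `|F t x − Finf (windowMap x)| ≤ ρ t · e^{−δ|windowMap x|₁}` — the scalar shape of
`VolumeRate` (see `volumeRate_iff_scalar`).  A `Prop`, used only to the left of `→`. [cite: Balaban1987RG1, (1.21) p.264] -/
def ScalarVolumeRate (side : ℕ → ℕ) [∀ t, NeZero (side t)] (F : (t : ℕ) → Site d (side t) → ℝ)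
    (Finf : (Fin d → ℤ) → ℝ) (ρ : ℕ → ℝ) (δ : ℝ) : Prop :=
  ∀ (t : ℕ) (x : Site d (side t)),
    |F t x - Finf (windowMap d (side t) x)| ≤ ρ t * Real.exp (-δ * l1 (windowMap d (side t) x))

/-- `VolumeRate` is `ScalarVolumeRate` for every index pair (definitional). [folklore] -/
theorem volumeRate_iff_scalar {P : (t : ℕ) → Fin d → Fin d → Site d (side t) → ℝ} {Pinf : B12Beta.Kernel d}
    {ρ : ℕ → ℝ} {δ : ℝ} :
    VolumeRate side P Pinf ρ δ ↔ ∀ μ ν : Fin d, ScalarVolumeRate side (fun t => P t μ ν) (Pinf μ ν) ρ δ :=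
  ⟨fun h μ ν t x => h t μ ν x, fun h t μ ν x => h μ ν t x⟩

/-- **THE METHOD OF IMAGES GIVES AN EXPLICIT RATE (scalar form).**  If `F t` is the image sum of `Finf` and
`|Finf y| ≤ C e^{−δ|y|₁}` with `δ > 0`, then for every torus point `x` with window representative `w`,
`|F t x − Finf w| ≤ C · imageTail d (δ·side t/4) · e^{−(δ/2)|w|₁}`: the `n ≠ 0` images satisfy
`|w + s·n|₁ ≥ ½|w|₁ + (s/4)|n|₁` (§1). [folklore] -/
theorem IsImageSum.scalarVolumeRate {F : (t : ℕ) → Site d (side t) → ℝ} {Finf : (Fin d → ℤ) → ℝ} {C δ : ℝ}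
    (himg : IsImageSum side F Finf) (hinf : Decay510 Finf C δ) (hδ : 0 < δ) :
    ScalarVolumeRate side F Finf (fun t => C * imageTail d (δ * side t / 4)) (δ / 2) := by
  intro t x
  show |F t x - Finf (windowMap d (side t) x)| ≤
    C * imageTail d (δ * side t / 4) * Real.exp (-(δ / 2) * l1 (windowMap d (side t) x))
  have hC : 0 ≤ C := decay510_constant_nonneg hinf
  have hs4 : 0 < δ * side t / 4 := by
    have : (0 : ℝ) < side t := by exact_mod_cast NeZero.pos (side t)
    positivity
  have hwin : ∀ i, InWindow (side t) (windowMap d (side t) x i) := inWindow_windowMap x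
  have h0 := himg t x
  generalize windowMap d (side t) x = w at hwin h0 ⊢
  have hsum : Summable (fun n : Fin d → ℤ => Finf (imageShift (side t) w n)) := h0.summable
  -- split off the image `n = 0`
  have hF : F t x - Finf w = ∑' n : Fin d → ℤ, (if n = 0 then 0 else Finf (imageShift (side t) w n)) := by
    have e := hsum.tsum_eq_add_tsum_ite 0
    simp only [imageShift_zero] at e
    rw [← h0.tsum_eq, e]
    ring
  -- termwise bound on the remaining images (§1 geometry)
  have hbd : ∀ n : Fin d → ℤ, ‖(if n = 0 then (0 : ℝ) else Finf (imageShift (side t) w n))‖ ≤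
      C * Real.exp (-(δ / 2) * l1 w) * (if n = 0 then (0 : ℝ) else Real.exp (-(δ * side t / 4) * l1 n)) := by
    intro n
    split_ifs with hn
    · simp
    · rw [Real.norm_eq_abs]
      calc |Finf (imageShift (side t) w n)| ≤ C * Real.exp (-δ * l1 (imageShift (side t) w n)) := hinf _
        _ ≤ C * (Real.exp (-(δ / 2) * l1 w) * Real.exp (-(δ * side t / 4) * l1 n)) :=
            mul_le_mul_of_nonneg_left (exp_imageShift_le hδ.le hwin n) hC
        _ = _ := by ring
  have hg : HasSum (fun n : Fin d → ℤ =>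
      C * Real.exp (-(δ / 2) * l1 w) * (if n = 0 then (0 : ℝ) else Real.exp (-(δ * side t / 4) * l1 n)))
      (C * Real.exp (-(δ / 2) * l1 w) * imageTail d (δ * side t / 4)) :=
    ((summable_imageTail_term hs4).hasSum).mul_left _
  have key := tsum_of_norm_bounded hg hbd
  rw [Real.norm_eq_abs, ← hF] at key
  calc |F t x - Finf w| ≤ C * Real.exp (-(δ / 2) * l1 w) * imageTail d (δ * side t / 4) := key
    _ = C * imageTail d (δ * side t / 4) * Real.exp (-(δ / 2) * l1 w) := by ring

variable {P : (t : ℕ) → Fin d → Fin d → Site d (side t) → ℝ} {Pinf : B12Beta.Kernel d} {C δ : ℝ}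

/-- **THE METHOD OF IMAGES GIVES AN EXPLICIT RATE** (kernel form): image sums of kernels obeying (5.10) with `(C, δ)`,
`δ > 0`, satisfy `VolumeRate side P Pinf (fun t => C·imageTail d (δ·side t/4)) (δ/2)` — an exponentially small, fully
explicit volume rate (`imageTail_le`). [cite: Balaban1987RG1, (1.21) p.264] -/
theorem IsImageSumKernel.volumeRate (himg : IsImageSumKernel side P Pinf) (hinf : ∀ μ ν, Decay510 (Pinf μ ν) C δ)
    (hδ : 0 < δ) : VolumeRate side P Pinf (fun t => C * imageTail d (δ * side t / 4)) (δ / 2) :=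
  volumeRate_iff_scalar.mpr fun μ ν => (himg μ ν).scalarVolumeRate (hinf μ ν) hδ

/-- (5.10) is monotone in the rate: `Decay510 K C δ` and `δ' ≤ δ` give `Decay510 K C δ'`. [folklore] -/
theorem decay510_mono {K : (Fin d → ℤ) → ℝ} {C δ δ' : ℝ} (h : Decay510 K C δ) (hle : δ' ≤ δ) : Decay510 K C δ' := by
  intro y
  have hC : 0 ≤ C := decay510_constant_nonneg h
  refine (h y).trans (mul_le_mul_of_nonneg_left ?_ hC)
  rw [Real.exp_le_exp]
  nlinarith [l1_nonneg y]

/-- **IMAGES ⇒ (1.21).**  Image sums of (5.10)-decaying kernels (`δ > 0`) converge pointwise to the `ℤ^d` kernel along any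
sides `side t → ∞` — pv25's `IsInfiniteVolumeLimit side P Pinf`. [cite: Balaban1987RG1, (1.21) p.264] -/
theorem IsImageSumKernel.isInfiniteVolumeLimit (himg : IsImageSumKernel side P Pinf)
    (hinf : ∀ μ ν, Decay510 (Pinf μ ν) C δ) (hδ : 0 < δ) (hside : Tendsto side atTop atTop) :
    IsInfiniteVolumeLimit side P Pinf :=
  (himg.volumeRate hinf hδ).isInfiniteVolumeLimit (tendsto_imageTail_side hδ hside d C) hside

/-- **IMAGES ⇒ THE EXPLICIT SECOND-MOMENT ERROR.**  For image sums of (5.10)-decaying kernels, on EVERY torus `t`: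
`|torusSecondMoment (P t) μ ν − B12Beta.secondMoment Pinf μ ν| ≤ imageError d C δ (side t)
 = β′(C·imageTail d (δ·side t/4), δ/2) + e^{−(δ/2)·side t/4}·β′(C, δ/4)` (`abs_torusSecondMoment_sub_secondMoment_le`
of `InfiniteVolumeRate` at the explicit rate of `IsImageSumKernel.volumeRate`). [cite: Balaban1987RG1, (1.22) p.264] -/
theorem IsImageSumKernel.abs_torusSecondMoment_sub_le (himg : IsImageSumKernel side P Pinf)
    (hinf : ∀ μ ν, Decay510 (Pinf μ ν) C δ) (hδ : 0 < δ) (t : ℕ) (μ ν : Fin d) :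
    |torusSecondMoment (P t) μ ν - B12Beta.secondMoment Pinf μ ν| ≤ imageError d C δ (side t) :=
  abs_torusSecondMoment_sub_secondMoment_le (half_pos hδ) (fun μ ν => decay510_mono (hinf μ ν) (by linarith))
    (himg.volumeRate hinf hδ) t μ ν

omit [∀ t, NeZero (side t)] in
/-- The images error tends to `0` along growing sides (`δ > 0`): `InfiniteVolumeRate.tendsto_volumeError` at the explicit
rate. [folklore] -/
theorem tendsto_imageError {δ : ℝ} (hδ : 0 < δ) (hside : Tendsto side atTop atTop) (d : ℕ) (C : ℝ) :
    Tendsto (fun t => imageError d C δ (side t)) atTop (𝓝 0) :=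
  tendsto_volumeError (half_pos hδ) (tendsto_imageTail_side hδ hside d C) hside C

end Images

/-! ## §4. A calculus of volume rates: sums, scalar multiples, pointwise products -/

section Calculus

variable {d : ℕ} {side : ℕ → ℕ} [∀ t, NeZero (side t)]
  {F₁ F₂ : (t : ℕ) → Site d (side t) → ℝ} {Finf₁ Finf₂ : (Fin d → ℤ) → ℝ} {ρ₁ ρ₂ : ℕ → ℝ} {δ : ℝ}

/-- Rates are `≥ 0` (read the bound at the origin). [folklore] -/
theorem ScalarVolumeRate.nonneg (h : ScalarVolumeRate side F₁ Finf₁ ρ₁ δ) (t : ℕ) : 0 ≤ ρ₁ t :=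
  nonneg_of_abs_le_mul_exp (h t fun _ => 0)

/-- SUMS: rates add. [folklore] -/
theorem ScalarVolumeRate.add (h₁ : ScalarVolumeRate side F₁ Finf₁ ρ₁ δ) (h₂ : ScalarVolumeRate side F₂ Finf₂ ρ₂ δ) :
    ScalarVolumeRate side (fun t x => F₁ t x + F₂ t x) (fun y => Finf₁ y + Finf₂ y) (fun t => ρ₁ t + ρ₂ t) δ := by
  intro t x
  show |F₁ t x + F₂ t x - (Finf₁ (windowMap d (side t) x) + Finf₂ (windowMap d (side t) x))| ≤
    (ρ₁ t + ρ₂ t) * Real.exp (-δ * l1 (windowMap d (side t) x))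
  have e1 := h₁ t x
  have e2 := h₂ t x
  calc |F₁ t x + F₂ t x - (Finf₁ (windowMap d (side t) x) + Finf₂ (windowMap d (side t) x))|
      = |(F₁ t x - Finf₁ (windowMap d (side t) x)) + (F₂ t x - Finf₂ (windowMap d (side t) x))| := by ring_nf
    _ ≤ |F₁ t x - Finf₁ (windowMap d (side t) x)| + |F₂ t x - Finf₂ (windowMap d (side t) x)| := abs_add_le _ _
    _ ≤ _ := by rw [add_mul]; exact add_le_add e1 e2

/-- SCALAR MULTIPLES: the rate scales by `|c|`. [folklore] -/
theorem ScalarVolumeRate.const_mul (h : ScalarVolumeRate side F₁ Finf₁ ρ₁ δ) (c : ℝ) :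
    ScalarVolumeRate side (fun t x => c * F₁ t x) (fun y => c * Finf₁ y) (fun t => |c| * ρ₁ t) δ := by
  intro t x
  show |c * F₁ t x - c * Finf₁ (windowMap d (side t) x)| ≤ |c| * ρ₁ t * Real.exp (-δ * l1 (windowMap d (side t) x))
  rw [← mul_sub, abs_mul, mul_assoc]
  exact mul_le_mul_of_nonneg_left (h t x) (abs_nonneg c)

/-- A rate makes the torus function bounded by `C + ρ t` when the limit is `(C, δ')`-decaying with `δ' ≥ 0` and the rate's
`δ ≥ 0`. [folklore] -/
theorem ScalarVolumeRate.abs_le (h : ScalarVolumeRate side F₁ Finf₁ ρ₁ δ) (hδ : 0 ≤ δ) {C δ' : ℝ}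
    (hinf : Decay510 Finf₁ C δ') (hδ' : 0 ≤ δ') (t : ℕ) (x : Site d (side t)) : |F₁ t x| ≤ C + ρ₁ t := by
  have hC : 0 ≤ C := decay510_constant_nonneg hinf
  have hρ : 0 ≤ ρ₁ t := h.nonneg t
  have h1' := h t x
  generalize windowMap d (side t) x = w at h1'
  have e1 : Real.exp (-δ * l1 w) ≤ 1 := Real.exp_le_one_iff.mpr (by nlinarith [l1_nonneg w])
  have e2 : Real.exp (-δ' * l1 w) ≤ 1 := Real.exp_le_one_iff.mpr (by nlinarith [l1_nonneg w])
  have h1 : |F₁ t x - Finf₁ w| ≤ ρ₁ t := h1'.trans (by nlinarith)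
  have h2 : |Finf₁ w| ≤ C := (hinf w).trans (by nlinarith)
  have h3 := abs_sub_abs_le_abs_sub (F₁ t x) (Finf₁ w)
  linarith

/-- **POINTWISE PRODUCTS**: if `F₁ → Finf₁` at rate `ρ₁` and `F₂ → Finf₂` at rate `ρ₂` (same `δ ≥ 0`) and the limits are
bounded through (5.10)-type decay with constants `C₁`, `C₂` (rates `≥ 0`), then `F₁·F₂ → Finf₁·Finf₂` at rate
`ρ₁(C₂ + ρ₂) + C₁ρ₂`:  `F₁F₂ − Finf₁Finf₂ = (F₁ − Finf₁)F₂ + Finf₁(F₂ − Finf₂)`. [folklore] -/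
theorem ScalarVolumeRate.mul (h₁ : ScalarVolumeRate side F₁ Finf₁ ρ₁ δ) (h₂ : ScalarVolumeRate side F₂ Finf₂ ρ₂ δ)
    (hδ : 0 ≤ δ) {C₁ C₂ δ₁ δ₂ : ℝ} (hinf₁ : Decay510 Finf₁ C₁ δ₁) (hδ₁ : 0 ≤ δ₁) (hinf₂ : Decay510 Finf₂ C₂ δ₂)
    (hδ₂ : 0 ≤ δ₂) :
    ScalarVolumeRate side (fun t x => F₁ t x * F₂ t x) (fun y => Finf₁ y * Finf₂ y)
      (fun t => ρ₁ t * (C₂ + ρ₂ t) + C₁ * ρ₂ t) δ := by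
  intro t x
  show |F₁ t x * F₂ t x - Finf₁ (windowMap d (side t) x) * Finf₂ (windowMap d (side t) x)| ≤
    (ρ₁ t * (C₂ + ρ₂ t) + C₁ * ρ₂ t) * Real.exp (-δ * l1 (windowMap d (side t) x))
  have hC₁ : 0 ≤ C₁ := decay510_constant_nonneg hinf₁
  have a1 : |F₁ t x - Finf₁ (windowMap d (side t) x)| ≤ ρ₁ t * Real.exp (-δ * l1 (windowMap d (side t) x)) := h₁ t x
  have a2 : |F₂ t x - Finf₂ (windowMap d (side t) x)| ≤ ρ₂ t * Real.exp (-δ * l1 (windowMap d (side t) x)) := h₂ t x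
  have b2 : |F₂ t x| ≤ C₂ + ρ₂ t := h₂.abs_le hδ hinf₂ hδ₂ t x
  generalize windowMap d (side t) x = w at a1 a2 ⊢
  generalize hE : Real.exp (-δ * l1 w) = E at a1 a2 ⊢
  have hEpos : 0 < E := hE ▸ Real.exp_pos _
  have b1 : |Finf₁ w| ≤ C₁ := by
    have e2 : Real.exp (-δ₁ * l1 w) ≤ 1 := Real.exp_le_one_iff.mpr (by nlinarith [l1_nonneg w])
    exact (hinf₁ w).trans (by nlinarith)
  have hsplit : F₁ t x * F₂ t x - Finf₁ w * Finf₂ w =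
      (F₁ t x - Finf₁ w) * F₂ t x + Finf₁ w * (F₂ t x - Finf₂ w) := by ring
  rw [hsplit]
  calc |(F₁ t x - Finf₁ w) * F₂ t x + Finf₁ w * (F₂ t x - Finf₂ w)|
      ≤ |(F₁ t x - Finf₁ w) * F₂ t x| + |Finf₁ w * (F₂ t x - Finf₂ w)| := abs_add_le _ _
    _ = |F₁ t x - Finf₁ w| * |F₂ t x| + |Finf₁ w| * |F₂ t x - Finf₂ w| := by rw [abs_mul, abs_mul]
    _ ≤ ρ₁ t * E * (C₂ + ρ₂ t) + C₁ * (ρ₂ t * E) :=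
        add_le_add (mul_le_mul a1 b2 (abs_nonneg _) (by nlinarith [h₁.nonneg t]))
          (mul_le_mul b1 a2 (abs_nonneg _) hC₁)
    _ = (ρ₁ t * (C₂ + ρ₂ t) + C₁ * ρ₂ t) * E := by ring

/-- The product of two (5.10)-decaying `ℤ^d` functions decays with the sum of the rates and the product of the constants
(so §3/§4 can be iterated). [folklore] -/
theorem decay510_mul {K₁ K₂ : (Fin d → ℤ) → ℝ} {C₁ C₂ δ₁ δ₂ : ℝ} (h₁ : Decay510 K₁ C₁ δ₁) (h₂ : Decay510 K₂ C₂ δ₂) :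
    Decay510 (fun y => K₁ y * K₂ y) (C₁ * C₂) (δ₁ + δ₂) := by
  intro y
  have hC₁ : 0 ≤ C₁ := decay510_constant_nonneg h₁
  rw [abs_mul]
  calc |K₁ y| * |K₂ y| ≤ C₁ * Real.exp (-δ₁ * l1 y) * (C₂ * Real.exp (-δ₂ * l1 y)) :=
        mul_le_mul (h₁ y) (h₂ y) (abs_nonneg _) (mul_nonneg hC₁ (Real.exp_pos _).le)
    _ = C₁ * C₂ * Real.exp (-(δ₁ + δ₂) * l1 y) := by
        rw [show -(δ₁ + δ₂) * l1 y = -δ₁ * l1 y + -δ₂ * l1 y by ring, Real.exp_add]; ring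

/-- Image sums are additive and homogeneous in the `ℤ^d` function (so LINEAR expressions in image sums are image sums;
products are not — see the module docstring). [folklore] -/
theorem IsImageSum.add (h₁ : IsImageSum side F₁ Finf₁) (h₂ : IsImageSum side F₂ Finf₂) :
    IsImageSum side (fun t x => F₁ t x + F₂ t x) (fun y => Finf₁ y + Finf₂ y) :=
  fun t x => (h₁ t x).add (h₂ t x)

/-- Image sums are homogeneous in the `ℤ^d` function. [folklore] -/
theorem IsImageSum.const_mul (h : IsImageSum side F₁ Finf₁) (c : ℝ) :
    IsImageSum side (fun t x => c * F₁ t x) (fun y => c * Finf₁ y) :=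
  fun t x => (h t x).mul_left c

end Calculus

/-! ## §5. Read on pv25's `OneLoopDictionary`: the (AF-0s) list from images + (5.10) + certified torus values -/

section Dictionary

variable {d c : ℕ} {β : (k : ℕ) → (Fin (k + 1) → ℝ) → ℝ} {S : B12Beta.OneLoopSplit β}

/-- **Explicit error for row num's observable, images form.**  For a dictionary `D`, a scale `k`, a colour `a`: if the
one-loop limit kernel `D.limKernel k` obeys (5.10) with `(C, δ)`, `δ > 0`, and the torus kernels
`torusKernel (D.model k t) a` ARE ITS IMAGE SUMS (`IsImageSumKernel` — the structural hypothesis of §3, NOT printed),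
then for every volume index `t` and `μ ≠ ν`: `|β⁰_T − S.β0 k| ≤ imageError d C δ (D.side k t)`.  Compared with
`InfiniteVolumeRate.OneLoopDictionary.abs_torusBetaZero_sub_beta0_le` the free rate `ρ` is gone: the error is explicit in
`(d, C, δ, side)`.  Nothing about Bałaban's kernels is asserted. [cite: Balaban1987RG1, (1.22) p.264] -/
theorem OneLoopDictionary.abs_torusBetaZero_sub_beta0_le_of_images (D : OneLoopDictionary d c S) (k : ℕ) (a : Fin c)
    {C δ : ℝ} (hδ : 0 < δ) (hinf : ∀ μ ν, Decay510 (D.limKernel k μ ν) C δ)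
    (himg : IsImageSumKernel (D.side k) (fun t => torusKernel (D.model k t) a) (D.limKernel k))
    {μ ν : Fin d} (hμν : μ ≠ ν) (t : ℕ) :
    |torusBetaZero (D.model k t) a μ ν - S.β0 k| ≤ imageError d C δ (D.side k t) := by
  rw [D.beta0_eq k μ ν hμν]
  exact himg.abs_torusSecondMoment_sub_le hinf hδ t μ ν

/-- **(AF-0s) END-TO-END, images form.**  (5.10) for the one-loop limit kernels at the scales `k < k₀` (constants
`C, δ`, `δ > 0`), the image-sum structure of the torus kernels there, and for each such `k` ONE volume `t` with a
certified inequality `3β⁰_∞/4 + imageError d C δ (D.side k t) ≤ β⁰_T` give the literal binder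
`hsmall : ∀ k < k₀, 3β⁰_∞/4 ≤ S.β0 k` of `FlowStepRuns.thm2Printed_of_limitSplit` (`μ ≠ ν`).
[cite: Balaban1987RG1, (1.22) p.264] -/
theorem OneLoopDictionary.hsmall_of_images (D : OneLoopDictionary d c S) (a : Fin c) {μ ν : Fin d} (hμν : μ ≠ ν)
    {C δ : ℝ} (hδ : 0 < δ) {binf : ℝ} {k₀ : ℕ}
    (hinf : ∀ k, k < k₀ → ∀ μ' ν', Decay510 (D.limKernel k μ' ν') C δ)
    (himg : ∀ k, k < k₀ → IsImageSumKernel (D.side k) (fun t => torusKernel (D.model k t) a) (D.limKernel k))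
    (hcert : ∀ k, k < k₀ → ∃ t, 3 * binf / 4 + imageError d C δ (D.side k t) ≤ torusBetaZero (D.model k t) a μ ν) :
    ∀ k, k < k₀ → 3 * binf / 4 ≤ S.β0 k :=
  D.beta0_lower_of_certifiedTori a μ ν (fun k t => imageError d C δ (D.side k t))
    (fun k t hk => D.abs_torusBetaZero_sub_beta0_le_of_images k a hδ (hinf k hk) (himg k hk) hμν t) hcert

end Dictionary

end Literature.MathematicalPhysics.QuantumFieldTheory.Balaban1983to89.Beta
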